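import Summits.Ventures.LatticeQCDFlow.Scaling.ParallelTemperingPairSwapKernel
import Summits.Ventures.LatticeQCDFlow.Exactness.AdjointKernels

/-!
HONEST FRAMING: exact (Metropolis-corrected) sampling algorithms for lattice gauge theory; figures
of merit are autocorrelation/cost numbers at stated couplings and volumes; no continuum-physics
claim.

# ParallelTemperingPairCycle — A SWEEP OF SWAP ATTEMPTS OVER ANY LIST OF PAIRWISE DISJOINT ADJACENT PAIRS AS ONE
# MARKOV KERNEL: DETAILED BALANCE (THE PAIR KERNELS COMMUTE), CLOSED LEVEL SETS, NEAREST-NEIGHBOUR TAG MOVES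
# (lean-2 GEN-15, ours)

Venture-side (OURS).  Cell `lqcd-flow` (pub-lqcd), unit `pub-lqcd-lean-2-g15`, 2026-08-24.  The replica-exchange
step of PTBC as run is not one uniformly chosen pair (GEN-14 `ptSwapKernel`) but a SWEEP of swap attempts over
disjoint adjacent pairs — the even pairs `(0,1), (2,3), …`, then the odd pairs `(1,2), (3,4), …`.  This file treats
the sweep over an ARBITRARY list `js` of pairwise disjoint pairs (`j + 2 ≤ j'` or `j' + 2 ≤ j` for distinct
entries) as ONE kernel, the composition `ptPairCycle js = cycle (js.map κ_j)` of GEN-15's pair kernels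
(`Scaling/ParallelTemperingPairSwapKernel`) in the sense of row 9's `Exactness/InvariantComposition.cycle`, and
proves the three hypotheses of GEN-13's replica-exchange law for it, with the tag-move probability EXACT.

## What is proved (`X` bounded measurable, `μ` a probability measure where the target enters)

* §1 general kernel algebra over `cycle`: `comp_cycle_comm` / **`cycle_reverse_eq_of_pairwise_comm`** (pairwise
  commuting members ⇒ the reversed cycle is the same kernel) ⇒ **`isReversible_cycle_of_pairwise_comm`** (with
  row 9's `isAdjointPair_cycle_reverse`: a cycle of pairwise COMMUTING reversible Markov kernels is reversible);
  **`cycle_absorbing`** (a measurable set that no member leaves is not left by the cycle).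
* §2 **`ptPairCycle hXm β K js`**; Markov; `invariant_ptPairCycle` (every list); **`isReversible_ptPairCycle`**
  (pairwise disjoint list — DETAILED BALANCE of the half-sweep).
* §3 tag geometry: `ptPairCycle_tagClosed` (a set of levels closed under the transpositions of `js` is not left);
  (ii) **`ptPairCycle_nearestNeighbour`** (pairwise disjoint); `ptPairCycle_ratio_ae_eq` (the ratio of a pair
  disjoint from `js` is a.s. unchanged by the sweep).
* (iii), the EXACT tag-move probability `Σ_{j ∈ js} ptTagCoef_j·r_j` and its stationary mean, is the companion
  `Scaling/ParallelTemperingPairCycleMoves`.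

NOT CLAIMED here: the even/odd specialisation and the laws (`Scaling/ParallelTemperingHalfSweep`);
anything measured.  Literature grade (cell rule): TEXTBOOK ALGORITHM (PTBC: Hasenbusch 2017; Bonanno–Bonati–D'Elia
2021; replica exchange: Hukushima–Nemoto 1996), NEW TYPING; nothing cited as a fact; no new bib keys.
-/

noncomputable section

open MeasureTheory ProbabilityTheory Set Filter Finset
open Summit.Ventures.LatticeQCDFlow.Exactness
open scoped ENNReal

namespace Summit.Ventures.LatticeQCDFlow.Scaling

/-! ## §1 Kernel algebra over `cycle`: commuting members, absorbing sets -/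

section CycleAlgebra

variable {α : Type*} [MeasurableSpace α] {π : Measure α}

/-- A kernel commuting with every member of a list commutes with their cycle. [folklore] -/
theorem comp_cycle_comm (κ : Kernel α α) {Ks : List (Kernel α α)} (h : ∀ η ∈ Ks, κ ∘ₖ η = η ∘ₖ κ) :
    κ ∘ₖ cycle Ks = cycle Ks ∘ₖ κ := by
  induction Ks with
  | nil => rw [cycle_nil, Kernel.comp_id, Kernel.id_comp]
  | cons η ks ih =>
      rw [cycle_cons, ← Kernel.comp_assoc, h η (by simp), Kernel.comp_assoc,
        ih fun η' hη' => h η' (by simp [hη']), Kernel.comp_assoc]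

/-- **Pairwise commuting members ⇒ the reversed cycle is the same kernel.** [folklore] -/
theorem cycle_reverse_eq_of_pairwise_comm {Ks : List (Kernel α α)}
    (h : Ks.Pairwise fun κ η => κ ∘ₖ η = η ∘ₖ κ) : cycle Ks.reverse = cycle Ks := by
  induction Ks with
  | nil => rfl
  | cons κ ks ih =>
      rw [List.pairwise_cons] at h
      rw [List.reverse_cons, cycle_append, cycle_cons, cycle_nil, Kernel.comp_id, ih h.2, cycle_cons,
        comp_cycle_comm κ h.1]

/-- **A cycle of pairwise COMMUTING `π`-reversible Markov kernels is `π`-reversible** (`π` finite). [ours] -/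
theorem isReversible_cycle_of_pairwise_comm [IsFiniteMeasure π] {Ks : List (Kernel α α)}
    (hM : ∀ κ ∈ Ks, IsMarkovKernel κ) (hrev : ∀ κ ∈ Ks, Kernel.IsReversible κ π)
    (hcomm : Ks.Pairwise fun κ η => κ ∘ₖ η = η ∘ₖ κ) : Kernel.IsReversible (cycle Ks) π := by
  have h := isAdjointPair_cycle_reverse hM hrev
  rw [cycle_reverse_eq_of_pairwise_comm hcomm] at h
  exact isAdjointPair_self_iff.1 h

/-- One Markov step from inside a measurable set `A` that no point of `A` leaves stays in `A`. [folklore] -/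
theorem comp_absorbing {κ η : Kernel α α} {A : Set α} (hA : MeasurableSet A)
    (hκ : ∀ y ∈ A, κ y Aᶜ = 0) {z : α} (hη : η z Aᶜ = 0) : (κ ∘ₖ η) z Aᶜ = 0 := by
  rw [Kernel.comp_apply' _ _ _ hA.compl]
  refine (lintegral_eq_zero_iff (κ.measurable_coe hA.compl)).2 ?_
  have hae : ∀ᵐ y ∂(η z), y ∈ A := by
    rw [ae_iff]
    have e : {y | ¬ y ∈ A} = Aᶜ := rfl
    rw [e]; exact hη
  filter_upwards [hae] with y hy
  exact hκ y hy

/-- **AN ABSORBING SET OF EVERY MEMBER IS ABSORBING FOR THE CYCLE**: if no member lets a point of the measurable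
set `A` leave `A`, neither does the cycle. [folklore] -/
theorem cycle_absorbing {Ks : List (Kernel α α)} {A : Set α} (hA : MeasurableSet A)
    (h : ∀ κ ∈ Ks, ∀ y ∈ A, κ y Aᶜ = 0) : ∀ z ∈ A, cycle Ks z Aᶜ = 0 := by
  induction Ks with
  | nil =>
      intro z hz
      rw [cycle_nil, Kernel.id_apply, Measure.dirac_apply' _ hA.compl,
        Set.indicator_of_notMem (show z ∉ Aᶜ from fun h => h hz)]
  | cons κ ks ih =>
      intro z hz
      rw [cycle_cons]
      exact comp_absorbing hA (h κ (by simp)) (ih (fun η hη => h η (by simp [hη])) z hz)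

end CycleAlgebra

/-! ## §2 The sweep over a list of pairs -/

section Sweep

variable {Ω : Type*} [MeasurableSpace Ω] {X : Ω → ℝ} {μ : Measure Ω} {β : ℕ → ℝ} {K : ℕ}

/-- **THE SWEEP OF SWAP ATTEMPTS OVER THE LIST `js` OF ADJACENT PAIRS** (last entry attempted first, as in
`cycle`): `cycle (js.map κ_j)`. [ours] -/
def ptPairCycle {X : Ω → ℝ} (hXm : Measurable X) (β : ℕ → ℝ) (K : ℕ) (js : List (Fin K)) :
    Kernel (Fin (K + 1) × (Fin (K + 1) → Ω)) (Fin (K + 1) × (Fin (K + 1) → Ω)) :=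
  cycle (js.map (ptPairKernel hXm β K))

/-- `ptPairCycle [] = id`. [ours] -/
@[simp] theorem ptPairCycle_nil (hXm : Measurable X) : ptPairCycle hXm β K [] = Kernel.id := rfl

/-- `ptPairCycle (j :: js) = κ_j ∘ₖ ptPairCycle js`. [ours] -/
@[simp] theorem ptPairCycle_cons (hXm : Measurable X) (j : Fin K) (js : List (Fin K)) :
    ptPairCycle hXm β K (j :: js) = ptPairKernel hXm β K j ∘ₖ ptPairCycle hXm β K js := rfl

/-- The sweep is MARKOV. [ours] -/
instance isMarkovKernel_ptPairCycle (hXm : Measurable X) (js : List (Fin K)) :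
    IsMarkovKernel (ptPairCycle hXm β K js) := by
  unfold ptPairCycle
  refine isMarkovKernel_cycle fun κ hκ => ?_
  obtain ⟨j, _, rfl⟩ := List.mem_map.1 hκ
  infer_instance

/-- **(i) THE SWEEP LEAVES THE TAGGED TARGET INVARIANT** (every list of pairs). [ours] -/
theorem invariant_ptPairCycle [IsProbabilityMeasure μ] (hXm : Measurable X) (hXb : ∃ C, ∀ x, |X x| ≤ C)
    (js : List (Fin K)) : Kernel.Invariant (ptPairCycle hXm β K js) (ptTaggedTarget X μ β K) := by
  unfold ptPairCycle
  refine invariant_cycle fun κ hκ => ?_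
  obtain ⟨j, _, rfl⟩ := List.mem_map.1 hκ
  exact invariant_ptPairKernel hXm hXb j

/-- **DETAILED BALANCE OF THE SWEEP OVER PAIRWISE DISJOINT PAIRS**: the pair kernels commute
(`ptPairKernel_comm_of_apart`), so their cycle is reversible for the tagged target. [ours] -/
theorem isReversible_ptPairCycle [IsProbabilityMeasure μ] (hXm : Measurable X) (hXb : ∃ C, ∀ x, |X x| ≤ C)
    {js : List (Fin K)} (hjs : js.Pairwise fun j j' : Fin K => (j : ℕ) + 2 ≤ j' ∨ (j' : ℕ) + 2 ≤ j) :
    Kernel.IsReversible (ptPairCycle hXm β K js) (ptTaggedTarget X μ β K) := by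
  haveI := isProbabilityMeasure_ptTaggedTarget (μ := μ) (β := β) (K := K) hXm hXb
  unfold ptPairCycle
  refine isReversible_cycle_of_pairwise_comm (fun κ hκ => ?_) (fun κ hκ => ?_) ?_
  · obtain ⟨j, _, rfl⟩ := List.mem_map.1 hκ; infer_instance
  · obtain ⟨j, _, rfl⟩ := List.mem_map.1 hκ; exact isReversible_ptPairKernel hXm hXb j
  · rw [List.pairwise_map]
    exact hjs.imp fun {j j'} h => (ptPairKernel_comm_of_apart hXm (β := β) h).symm

end Sweep

/-! ## §3 Tag geometry: closed level sets, nearest-neighbour moves, untouched ratios -/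

section Geometry

variable {Ω : Type*} [MeasurableSpace Ω] {X : Ω → ℝ} {β : ℕ → ℝ} {K : ℕ}

/-- A set of levels, as a measurable subset of the tagged space. [folklore] -/
theorem measurableSet_tagMem (T : Set (Fin (K + 1))) :
    MeasurableSet {y : Fin (K + 1) × (Fin (K + 1) → Ω) | y.1 ∈ T} :=
  measurable_fst (MeasurableSet.of_discrete (s := T))

/-- The pair kernel does not leave a measurable set that contains, with each of its points, the proposal.
[folklore] -/
theorem ptPairKernel_absorbing (hXm : Measurable X) (j : Fin K) {A : Set (Fin (K + 1) × (Fin (K + 1) → Ω))}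
    (hA : MeasurableSet A) (hclosed : ∀ y ∈ A, ptSwapMap K j y ∈ A) : ∀ y ∈ A, ptPairKernel hXm β K j y Aᶜ = 0 := by
  intro y hy
  rw [ptPairKernel_apply' hXm j y hA.compl, Set.indicator_of_notMem (show ptSwapMap K j y ∉ Aᶜ from fun h => h (hclosed y hy)),
    Set.indicator_of_notMem (show y ∉ Aᶜ from fun h => h hy), mul_zero, mul_zero, add_zero]

/-- **A SET OF LEVELS CLOSED UNDER THE TRANSPOSITIONS OF `js` IS NOT LEFT BY THE SWEEP.** [ours] -/
theorem ptPairCycle_tagClosed (hXm : Measurable X) {js : List (Fin K)} {T : Set (Fin (K + 1))}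
    (hT : ∀ j ∈ js, ∀ τ ∈ T, ptPerm K j τ ∈ T) {z : Fin (K + 1) × (Fin (K + 1) → Ω)} (hz : z.1 ∈ T) :
    ptPairCycle hXm β K js z {y | y.1 ∈ T}ᶜ = 0 := by
  unfold ptPairCycle
  refine cycle_absorbing (measurableSet_tagMem T) (fun κ hκ => ?_) z hz
  obtain ⟨j, hj, rfl⟩ := List.mem_map.1 hκ
  exact ptPairKernel_absorbing hXm j (measurableSet_tagMem T) fun y hy => hT j hj y.1 hy

/-- Distinct entries of a pairwise-disjoint list of pairs are disjoint pairs. [folklore] -/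
theorem forall_apart_of_pairwise {js : List (Fin K)}
    (hjs : js.Pairwise fun j j' : Fin K => (j : ℕ) + 2 ≤ j' ∨ (j' : ℕ) + 2 ≤ j) :
    ∀ j ∈ js, ∀ j' ∈ js, j ≠ j' → ((j : ℕ) + 2 ≤ j' ∨ (j' : ℕ) + 2 ≤ j) := by
  induction js with
  | nil => simp
  | cons a l ih =>
      rw [List.pairwise_cons] at hjs
      intro j hj j' hj' hne
      simp only [List.mem_cons] at hj hj'
      rcases hj with rfl | hj <;> rcases hj' with rfl | hj'
      · exact (hne rfl).elim
      · exact hjs.1 j' hj'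
      · exact (hjs.1 j hj).symm
      · exact ih hjs.2 j hj j' hj' hne

/-- **(ii) A SWEEP OVER PAIRWISE DISJOINT PAIRS MOVES THE TAG BY AT MOST ONE LEVEL** (the tag stays on the pair
it sits on, or does not move at all). [ours] -/
theorem ptPairCycle_nearestNeighbour (hXm : Measurable X) {js : List (Fin K)}
    (hjs : js.Pairwise fun j j' : Fin K => (j : ℕ) + 2 ≤ j' ∨ (j' : ℕ) + 2 ≤ j) (z : Fin (K + 1) × (Fin (K + 1) → Ω)) :
    ∀ᵐ y ∂(ptPairCycle hXm β K js z), |(((y.1 : Fin (K + 1)) : ℕ) : ℝ) - ((z.1 : Fin (K + 1)) : ℕ)| ≤ 1 := by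
  by_cases hon : ∃ j ∈ js, ptPerm K j z.1 ≠ z.1
  · -- the tag sits on the pair `j`: the levels `{z.1, σ_j z.1}` are closed under every transposition of `js`
    obtain ⟨j, hj, hne⟩ := hon
    have hT : ∀ j' ∈ js, ∀ τ ∈ ({z.1, ptPerm K j z.1} : Set (Fin (K + 1))), ptPerm K j' τ ∈
        ({z.1, ptPerm K j z.1} : Set (Fin (K + 1))) := by
      intro j' hj' τ hτ
      by_cases hjj : j' = j
      · subst hjj
        rcases hτ with rfl | rfl
        · exact Or.inr rfl
        · rw [ptPerm_ptPerm]; exact Or.inl rfl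
      · -- distinct entries of `js` are disjoint pairs
        have hap : (j : ℕ) + 2 ≤ j' ∨ (j' : ℕ) + 2 ≤ j := forall_apart_of_pairwise hjs j hj j' hj' (Ne.symm hjj)
        have hne2 : ptPerm K j (ptPerm K j z.1) ≠ ptPerm K j z.1 := by rw [ptPerm_ptPerm]; exact hne.symm
        rcases hτ with rfl | rfl
        · rw [ptPerm_eq_self_of_apart hap.symm hne]; exact Or.inl rfl
        · rw [ptPerm_eq_self_of_apart hap.symm hne2]; exact Or.inr rfl
    have h0 := ptPairCycle_tagClosed hXm (β := β) hT (z := z) (Or.inl rfl)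
    rw [ae_iff]
    refine measure_mono_null (fun y hy => ?_) h0
    simp only [Set.mem_compl_iff, Set.mem_setOf_eq, Set.mem_insert_iff, Set.mem_singleton_iff, not_or]
    refine ⟨fun h => hy ?_, fun h => hy ?_⟩
    · rw [h, sub_self, abs_zero]; exact zero_le_one
    · rw [h]; exact abs_ptPerm_sub_le_one j z.1
  · -- the tag sits on no pair of `js`: it does not move
    push Not at hon
    have hT : ∀ j' ∈ js, ∀ τ ∈ ({z.1} : Set (Fin (K + 1))), ptPerm K j' τ ∈ ({z.1} : Set (Fin (K + 1))) := by
      intro j' hj' τ hτ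
      rw [Set.mem_singleton_iff] at hτ
      subst hτ
      exact hon j' hj'
    have h0 := ptPairCycle_tagClosed hXm (β := β) hT (z := z) rfl
    rw [ae_iff]
    refine measure_mono_null (fun y hy => ?_) h0
    simp only [Set.mem_compl_iff, Set.mem_setOf_eq, Set.mem_singleton_iff]
    intro h
    exact hy (by rw [h, sub_self, abs_zero]; exact zero_le_one)

/-- **THE RATIO OF A PAIR DISJOINT FROM `js` IS ALMOST SURELY UNCHANGED BY THE SWEEP.** [ours] -/
theorem ptPairCycle_ratio_ae_eq (hXm : Measurable X) {js : List (Fin K)} {j : Fin K}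
    (hj : ∀ j' ∈ js, (j : ℕ) + 2 ≤ j' ∨ (j' : ℕ) + 2 ≤ j) (z : Fin (K + 1) × (Fin (K + 1) → Ω)) :
    ptPairCycle hXm β K js z {y | ptPairRatio X β K j y.2 = ptPairRatio X β K j z.2}ᶜ = 0 := by
  have hA : MeasurableSet {y : Fin (K + 1) × (Fin (K + 1) → Ω) | ptPairRatio X β K j y.2 = ptPairRatio X β K j z.2} :=
    (measurable_ptPairRatio (β := β) hXm j).comp measurable_snd (measurableSet_singleton _)
  unfold ptPairCycle
  refine cycle_absorbing hA (fun κ hκ => ?_) z rfl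
  obtain ⟨j', hj', rfl⟩ := List.mem_map.1 hκ
  refine ptPairKernel_absorbing hXm j' hA fun y hy => ?_
  simp only [Set.mem_setOf_eq, ptSwapMap] at hy ⊢
  rw [ptPairRatio_confSwap_of_apart (Or.symm (hj j' hj')), hy]

end Geometry

end Summit.Ventures.LatticeQCDFlow.Scaling

end
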